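import Summits.Ventures.YMGap.FlowData.LinkCharacterMerging
import Summits.Ventures.YMGap.FlowData.SliceCharacterMerging
import HarnessLib

/-!
# Venture YMGap, track Y3 FLOW-DATA — the reproducing integrals of the product characters on an SU(2) slice:
# symmetry, orthogonality and BESSEL'S INEQUALITY without completeness (theorems only; file 2/2)

HONEST FRAMING: venture file of the cell `pub-ymgap` (QuantumFields programme), track Y3; companion THEOREMS for
`FlowData/TubeTransferOperator.lean` preparing the STRONG-COUPLING WINDOW for the typed torelon energy
(`FlowData/TubeStrongCouplingWindow.lean`).  Finite Haar integrals over `SU(2)^{links}`; no number, no row, nothing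
about limits or a mass gap.  NO Peter–Weyl: only the multi-link merging rule of file 1/2
(`integral_prod_su2Character_mul_prod`) and Fubini.

Notation of the docstrings (everything is spelled out in the statements): for a multi-index `ν : links → ℕ`,
`X_ν(a, b) = ∏_e χ_{ν_e}(b_e a_e⁻¹)`, `d_ν = ∏_e (ν_e + 1)`, `(p_ν h)(a) = d_ν ∫ X_ν(a, b) h(b) db`.

* `integral_mul_charProj_comm` — symmetry `∫ ψ · p_ν h = ∫ p_ν ψ · h`;
* **`integral_charProj_mul_charProj`** — the reproducing property `∫ p_ν ψ · p_{ν'} h = [ν = ν'] ∫ ψ · p_ν h`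
  (the `p_ν` are mutually orthogonal symmetric idempotents — no completeness statement is made or used);
* `integral_charProj_sq` — `∫ (p_ν h)² = ∫ h · p_ν h`;
* **`sum_integral_charProj_sq_le`** — BESSEL'S INEQUALITY `Σ_{ν ∈ F} ∫ (p_ν h)² ≤ ∫ h²` for every finite set `F` of
  multi-indices and every square-integrable `h` (`g = Σ_F p_ν h` has `∫ g² = ∫ h g`, then Cauchy–Schwarz);
* `abs_integral_mul_charProj_le` — `|∫ ψ · p_ν h| ≤ (∫ (p_ν ψ)²)^{1/2} (∫ (p_ν h)²)^{1/2}`.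

References: I. Montvay, G. Münster, *Quantum Fields on a Lattice* (1994) §3.4.2 [cite: MontvayMunster1994, §3.4.2];
J.-M. Drouffe, J.-B. Zuber, Phys. Rept. 102 (1983) 1, §3 [cite: DrouffeZuber1983, §3].
-/

noncomputable section

open scoped BigOperators Topology
open MeasureTheory Filter Function Set Polynomial.Chebyshev
open Literature.MathematicalPhysics.QuantumFieldTheory Literature.MathematicalPhysics.QuantumLattice Literature.Analysis.FunctionSpaces
open Literature.Analysis.OperatorTheory
open Summit.Ventures.LatticeQCDFlow.Exactness Summit.Ventures.LatticeQCDFlow.Scoring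

namespace Summit.Ventures.YMGap.FlowData.SU2Links

section Reproducing

variable {ι : Type*} [Fintype ι]

/-- **Symmetry of the reproducing integrals**: `∫ ψ · p_ν h = ∫ p_ν ψ · h` (Fubini and `X_ν(a,b) = X_ν(b,a)`).
[folklore] -/
theorem integral_mul_charProj_comm (ν : ι → ℕ)
    {ψ h : (ι → Matrix.specialUnitaryGroup (Fin 2) ℂ) → ℝ}
    (hψ : Integrable ψ ((Measure.pi fun _ : ι => haarProbability (Matrix.specialUnitaryGroup (Fin 2) ℂ))))
    (hh : Integrable h ((Measure.pi fun _ : ι => haarProbability (Matrix.specialUnitaryGroup (Fin 2) ℂ)))) :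
    ∫ a, ψ a * ((∏ e, ((ν e : ℝ) + 1)) * ∫ b, (∏ e, (U ℝ (ν e)).eval (su2a0 (b e * (a e)⁻¹))) * h b
        ∂((Measure.pi fun _ : ι => haarProbability (Matrix.specialUnitaryGroup (Fin 2) ℂ))))
        ∂((Measure.pi fun _ : ι => haarProbability (Matrix.specialUnitaryGroup (Fin 2) ℂ))) =
      ∫ b, ((∏ e, ((ν e : ℝ) + 1)) * ∫ a, (∏ e, (U ℝ (ν e)).eval (su2a0 (a e * (b e)⁻¹))) * ψ a
        ∂((Measure.pi fun _ : ι => haarProbability (Matrix.specialUnitaryGroup (Fin 2) ℂ)))) * h b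
        ∂((Measure.pi fun _ : ι => haarProbability (Matrix.specialUnitaryGroup (Fin 2) ℂ))) := by
  set μ := (Measure.pi fun _ : ι => haarProbability (Matrix.specialUnitaryGroup (Fin 2) ℂ)) with hμ
  set d : ℝ := ∏ e, ((ν e : ℝ) + 1) with hd
  -- the integrable kernel on the product
  set F : (ι → Matrix.specialUnitaryGroup (Fin 2) ℂ) →
      (ι → Matrix.specialUnitaryGroup (Fin 2) ℂ) → ℝ :=
    fun a b => ψ a * (d * ((∏ e, (U ℝ (ν e)).eval (su2a0 (b e * (a e)⁻¹))) * h b)) with hF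
  have hX : AEStronglyMeasurable (fun p : (ι → Matrix.specialUnitaryGroup (Fin 2) ℂ) ×
      (ι → Matrix.specialUnitaryGroup (Fin 2) ℂ) =>
      d * ∏ e, (U ℝ (ν e)).eval (su2a0 (p.2 e * (p.1 e)⁻¹))) (μ.prod μ) :=
    (continuous_const.mul (continuous_prod_su2Character_pair ν)).aestronglyMeasurable
  have hint : Integrable (uncurry F) (μ.prod μ) := by
    have h1 : Integrable (fun p : (ι → Matrix.specialUnitaryGroup (Fin 2) ℂ) ×
        (ι → Matrix.specialUnitaryGroup (Fin 2) ℂ) => ψ p.1 * h p.2) (μ.prod μ) := hψ.mul_prod hh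
    have h2 := h1.bdd_mul hX (c := |d| * d) (Eventually.of_forall fun p => by
      rw [norm_mul, Real.norm_eq_abs, Real.norm_eq_abs]
      exact mul_le_mul_of_nonneg_left (abs_prod_su2Character_le ν _) (abs_nonneg _))
    refine h2.congr (Eventually.of_forall fun p => ?_)
    simp only [uncurry, hF]
    ring
  have hswap := integral_integral_swap hint
  have hlhs : ∀ a : (ι → Matrix.specialUnitaryGroup (Fin 2) ℂ), ∫ b, F a b ∂μ =
      ψ a * (d * ∫ b, (∏ e, (U ℝ (ν e)).eval (su2a0 (b e * (a e)⁻¹))) * h b ∂μ) := fun a => by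
    simp only [hF]
    rw [integral_const_mul, integral_const_mul]
  have hrhs : ∀ b : (ι → Matrix.specialUnitaryGroup (Fin 2) ℂ), ∫ a, F a b ∂μ =
      (d * ∫ a, (∏ e, (U ℝ (ν e)).eval (su2a0 (a e * (b e)⁻¹))) * ψ a ∂μ) * h b := fun b => by
    simp only [hF]
    have : ∀ a : (ι → Matrix.specialUnitaryGroup (Fin 2) ℂ),
        ψ a * (d * ((∏ e, (U ℝ (ν e)).eval (su2a0 (b e * (a e)⁻¹))) * h b)) =
        (d * h b) * ((∏ e, (U ℝ (ν e)).eval (su2a0 (a e * (b e)⁻¹))) * ψ a) := fun a => by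
      rw [prod_su2Character_swap ν a b]; ring
    simp_rw [this]
    rw [integral_const_mul]
    ring
  simp_rw [hlhs] at hswap
  rw [hswap]
  exact integral_congr_ae (Eventually.of_forall hrhs)

/-- **The reproducing property**: `∫ p_ν ψ · p_{ν'} h = [ν = ν'] ∫ ψ · p_ν h` — the `p_ν` are mutually orthogonal
symmetric idempotents (merging rule + Fubini; no completeness). [cite: MontvayMunster1994, §3.4.2] -/
theorem integral_charProj_mul_charProj (ν ν' : ι → ℕ)
    {ψ h : (ι → Matrix.specialUnitaryGroup (Fin 2) ℂ) → ℝ}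
    (hψ : Integrable ψ ((Measure.pi fun _ : ι => haarProbability (Matrix.specialUnitaryGroup (Fin 2) ℂ))))
    (hh : Integrable h ((Measure.pi fun _ : ι => haarProbability (Matrix.specialUnitaryGroup (Fin 2) ℂ)))) :
    ∫ a, ((∏ e, ((ν e : ℝ) + 1)) * ∫ b, (∏ e, (U ℝ (ν e)).eval (su2a0 (b e * (a e)⁻¹))) * ψ b
          ∂((Measure.pi fun _ : ι => haarProbability (Matrix.specialUnitaryGroup (Fin 2) ℂ)))) *
        ((∏ e, ((ν' e : ℝ) + 1)) * ∫ c, (∏ e, (U ℝ (ν' e)).eval (su2a0 (c e * (a e)⁻¹))) * h c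
          ∂((Measure.pi fun _ : ι => haarProbability (Matrix.specialUnitaryGroup (Fin 2) ℂ))))
        ∂((Measure.pi fun _ : ι => haarProbability (Matrix.specialUnitaryGroup (Fin 2) ℂ))) =
      if ν = ν' then
        ∫ a, ψ a * ((∏ e, ((ν e : ℝ) + 1)) * ∫ b, (∏ e, (U ℝ (ν e)).eval (su2a0 (b e * (a e)⁻¹))) * h b
          ∂((Measure.pi fun _ : ι => haarProbability (Matrix.specialUnitaryGroup (Fin 2) ℂ))))
          ∂((Measure.pi fun _ : ι => haarProbability (Matrix.specialUnitaryGroup (Fin 2) ℂ)))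
      else 0 := by
  set μ := (Measure.pi fun _ : ι => haarProbability (Matrix.specialUnitaryGroup (Fin 2) ℂ)) with hμ
  set d : ℝ := ∏ e, ((ν e : ℝ) + 1) with hd
  set d' : ℝ := ∏ e, ((ν' e : ℝ) + 1) with hd'
  set P : (ι → Matrix.specialUnitaryGroup (Fin 2) ℂ) → ℝ :=
    fun a => d' * ∫ c, (∏ e, (U ℝ (ν' e)).eval (su2a0 (c e * (a e)⁻¹))) * h c ∂μ with hP
  have hPc : Continuous P := continuous_charProj ν' hh
  have hPi : Integrable P μ := hPc.integrable_of_hasCompactSupport (HasCompactSupport.of_compactSpace _)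
  -- Step 1: symmetry moves `p_ν` from `ψ` onto `P = p_{ν'} h`
  have h1 : ∫ a, (d * ∫ b, (∏ e, (U ℝ (ν e)).eval (su2a0 (b e * (a e)⁻¹))) * ψ b ∂μ) * P a ∂μ =
      ∫ b, ψ b * (d * ∫ a, (∏ e, (U ℝ (ν e)).eval (su2a0 (a e * (b e)⁻¹))) * P a ∂μ) ∂μ := by
    calc ∫ a, (d * ∫ b, (∏ e, (U ℝ (ν e)).eval (su2a0 (b e * (a e)⁻¹))) * ψ b ∂μ) * P a ∂μ
        = ∫ a, P a * (d * ∫ b, (∏ e, (U ℝ (ν e)).eval (su2a0 (b e * (a e)⁻¹))) * ψ b ∂μ) ∂μ :=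
          integral_congr_ae (Eventually.of_forall fun a => mul_comm _ _)
      _ = ∫ b, (d * ∫ a, (∏ e, (U ℝ (ν e)).eval (su2a0 (a e * (b e)⁻¹))) * P a ∂μ) * ψ b ∂μ :=
          integral_mul_charProj_comm ν hPi hψ
      _ = ∫ b, ψ b * (d * ∫ a, (∏ e, (U ℝ (ν e)).eval (su2a0 (a e * (b e)⁻¹))) * P a ∂μ) ∂μ :=
          integral_congr_ae (Eventually.of_forall fun b => mul_comm _ _)
  rw [h1]
  -- Step 2: the inner integral `∫ X_ν(b,a) P(a) da` by the merging rule
  have h2 : ∀ b : (ι → Matrix.specialUnitaryGroup (Fin 2) ℂ),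
      ∫ a, (∏ e, (U ℝ (ν e)).eval (su2a0 (a e * (b e)⁻¹))) * P a ∂μ =
      d' * ∫ c, (if ν = ν' then (∏ e, (U ℝ (ν e)).eval (su2a0 (c e * (b e)⁻¹))) / d else 0) * h c ∂μ := by
    intro b
    -- swap the `a` and `c` integrals
    set F : (ι → Matrix.specialUnitaryGroup (Fin 2) ℂ) →
        (ι → Matrix.specialUnitaryGroup (Fin 2) ℂ) → ℝ :=
      fun a c => (∏ e, (U ℝ (ν e)).eval (su2a0 (a e * (b e)⁻¹))) *
        (d' * ((∏ e, (U ℝ (ν' e)).eval (su2a0 (c e * (a e)⁻¹))) * h c)) with hF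
    have hK : Continuous fun p : (ι → Matrix.specialUnitaryGroup (Fin 2) ℂ) ×
        (ι → Matrix.specialUnitaryGroup (Fin 2) ℂ) =>
        (∏ e, (U ℝ (ν e)).eval (su2a0 (p.1 e * (b e)⁻¹))) *
          (d' * ∏ e, (U ℝ (ν' e)).eval (su2a0 (p.2 e * (p.1 e)⁻¹))) :=
      ((continuous_prod_su2Character_right ν b).comp continuous_fst).mul
        (continuous_const.mul (continuous_prod_su2Character_pair ν'))
    obtain ⟨C, hC⟩ := isCompact_univ.exists_bound_of_continuousOn hK.continuousOn
    have hint : Integrable (uncurry F) (μ.prod μ) := by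
      have h0 : Integrable (fun p : (ι → Matrix.specialUnitaryGroup (Fin 2) ℂ) ×
          (ι → Matrix.specialUnitaryGroup (Fin 2) ℂ) => (1 : ℝ) * h p.2) (μ.prod μ) :=
        (integrable_const (1 : ℝ)).mul_prod hh
      have h0' := h0.bdd_mul hK.aestronglyMeasurable (c := C)
        (Eventually.of_forall fun p => hC p (Set.mem_univ _))
      refine h0'.congr (Eventually.of_forall fun p => ?_)
      simp only [uncurry, hF]
      ring
    have hsw := integral_integral_swap hint
    have hl : ∀ a : (ι → Matrix.specialUnitaryGroup (Fin 2) ℂ),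
        ∫ c, F a c ∂μ = (∏ e, (U ℝ (ν e)).eval (su2a0 (a e * (b e)⁻¹))) * P a := fun a => by
      simp only [hF, hP]
      rw [integral_const_mul, integral_const_mul]
    simp_rw [hl] at hsw
    rw [hsw]
    have hr : ∀ c : (ι → Matrix.specialUnitaryGroup (Fin 2) ℂ), ∫ a, F a c ∂μ =
        d' * ((if ν = ν' then (∏ e, (U ℝ (ν e)).eval (su2a0 (c e * (b e)⁻¹))) / d else 0) * h c) := by
      intro c
      simp only [hF]
      have : ∀ a : (ι → Matrix.specialUnitaryGroup (Fin 2) ℂ),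
          (∏ e, (U ℝ (ν e)).eval (su2a0 (a e * (b e)⁻¹))) *
          (d' * ((∏ e, (U ℝ (ν' e)).eval (su2a0 (c e * (a e)⁻¹))) * h c)) =
          (d' * h c) * ((∏ e, (U ℝ (ν e)).eval (su2a0 (a e * (b e)⁻¹))) *
            (∏ e, (U ℝ (ν' e)).eval (su2a0 (c e * (a e)⁻¹)))) := fun a => by ring
      simp_rw [this]
      rw [integral_const_mul, integral_prod_su2Character_mul_prod ν ν' b c]
      ring
    simp_rw [hr]
    rw [integral_const_mul]
  simp_rw [h2]
  by_cases hν : ν = ν'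
  · subst hν
    simp only [if_true]
    refine integral_congr_ae (Eventually.of_forall fun b => ?_)
    have hd0 : d ≠ 0 := (prod_succ_pos (ι := ι) ν).ne'
    have : ∀ c : (ι → Matrix.specialUnitaryGroup (Fin 2) ℂ),
        (∏ e, (U ℝ (ν e)).eval (su2a0 (c e * (b e)⁻¹))) / d * h c =
        d⁻¹ * ((∏ e, (U ℝ (ν e)).eval (su2a0 (c e * (b e)⁻¹))) * h c) := fun c => by
      rw [div_eq_mul_inv]; ring
    simp_rw [this]
    rw [integral_const_mul, mul_left_comm d d', mul_inv_cancel_left₀ hd0]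
  · simp only [hν, if_false, zero_mul, integral_zero, mul_zero]

/-- **Positivity of the diagonal**: `∫ (p_ν h)² = ∫ h · p_ν h` (the case `ν = ν'` of the reproducing property).
[folklore] -/
theorem integral_charProj_sq (ν : ι → ℕ)
    {h : (ι → Matrix.specialUnitaryGroup (Fin 2) ℂ) → ℝ}
    (hh : Integrable h ((Measure.pi fun _ : ι => haarProbability (Matrix.specialUnitaryGroup (Fin 2) ℂ)))) :
    ∫ a, ((∏ e, ((ν e : ℝ) + 1)) * ∫ b, (∏ e, (U ℝ (ν e)).eval (su2a0 (b e * (a e)⁻¹))) * h b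
          ∂((Measure.pi fun _ : ι => haarProbability (Matrix.specialUnitaryGroup (Fin 2) ℂ)))) ^ 2
        ∂((Measure.pi fun _ : ι => haarProbability (Matrix.specialUnitaryGroup (Fin 2) ℂ))) =
      ∫ a, h a * ((∏ e, ((ν e : ℝ) + 1)) * ∫ b, (∏ e, (U ℝ (ν e)).eval (su2a0 (b e * (a e)⁻¹))) * h b
          ∂((Measure.pi fun _ : ι => haarProbability (Matrix.specialUnitaryGroup (Fin 2) ℂ))))
        ∂((Measure.pi fun _ : ι => haarProbability (Matrix.specialUnitaryGroup (Fin 2) ℂ))) := by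
  have h := integral_charProj_mul_charProj ν ν hh hh
  rw [if_pos rfl] at h
  rw [← h]
  exact integral_congr_ae (Eventually.of_forall fun a => by simp only [sq])

/-- **BESSEL'S INEQUALITY for the reproducing integrals**: for every finite set `F` of multi-indices and every
square-integrable `h`, `Σ_{ν ∈ F} ∫ (p_ν h)² ≤ ∫ h²` — with `g = Σ_{ν∈F} p_ν h` one has `∫ g² = Σ_ν ∫ h·p_ν h = ∫ h g`
by the reproducing property, and Cauchy–Schwarz. [folklore] -/
theorem sum_integral_charProj_sq_le (F : Finset (ι → ℕ))
    {h : (ι → Matrix.specialUnitaryGroup (Fin 2) ℂ) → ℝ}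
    (hh : MemLp h 2 ((Measure.pi fun _ : ι => haarProbability (Matrix.specialUnitaryGroup (Fin 2) ℂ)))) :
    ∑ ν ∈ F, ∫ a, ((∏ e, ((ν e : ℝ) + 1)) * ∫ b, (∏ e, (U ℝ (ν e)).eval (su2a0 (b e * (a e)⁻¹))) * h b
          ∂((Measure.pi fun _ : ι => haarProbability (Matrix.specialUnitaryGroup (Fin 2) ℂ)))) ^ 2
        ∂((Measure.pi fun _ : ι => haarProbability (Matrix.specialUnitaryGroup (Fin 2) ℂ))) ≤
      ∫ a, h a ^ 2 ∂((Measure.pi fun _ : ι => haarProbability (Matrix.specialUnitaryGroup (Fin 2) ℂ))) := by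
  set μ := (Measure.pi fun _ : ι => haarProbability (Matrix.specialUnitaryGroup (Fin 2) ℂ)) with hμ
  have hhi : Integrable h μ := hh.integrable one_le_two
  set p : (ι → ℕ) → (ι → Matrix.specialUnitaryGroup (Fin 2) ℂ) → ℝ :=
    fun ν a => (∏ e, ((ν e : ℝ) + 1)) * ∫ b, (∏ e, (U ℝ (ν e)).eval (su2a0 (b e * (a e)⁻¹))) * h b ∂μ with hp
  have hpc : ∀ ν, Continuous (p ν) := fun ν => continuous_charProj ν hhi
  have hpi : ∀ ν, Integrable (p ν) μ := fun ν =>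
    (hpc ν).integrable_of_hasCompactSupport (HasCompactSupport.of_compactSpace _)
  set g : (ι → Matrix.specialUnitaryGroup (Fin 2) ℂ) → ℝ := fun a => ∑ ν ∈ F, p ν a with hg
  have hgc : Continuous g := continuous_finsetSum _ fun ν _ => hpc ν
  have hg2 : MemLp g 2 μ := memLp_two_of_continuous hgc
  have hpb : ∀ ν, ∃ C, ∀ a, ‖p ν a‖ ≤ C := fun ν => by
    obtain ⟨C, hC⟩ := isCompact_univ.exists_bound_of_continuousOn (hpc ν).continuousOn
    exact ⟨C, fun a => hC a (Set.mem_univ _)⟩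
  -- `S := Σ_ν ∫ (p_ν h)² = Σ_ν ∫ h p_ν h = ∫ h g = ∫ g²`
  set S : ℝ := ∑ ν ∈ F, ∫ a, (p ν a) ^ 2 ∂μ with hS
  have hSnn : 0 ≤ S := Finset.sum_nonneg fun ν _ => integral_nonneg fun a => sq_nonneg _
  have hdiag : ∀ ν, ∫ a, (p ν a) ^ 2 ∂μ = ∫ a, h a * p ν a ∂μ := fun ν => integral_charProj_sq ν hhi
  have hint_hp : ∀ ν, Integrable (fun a => h a * p ν a) μ := fun ν => by
    obtain ⟨C, hC⟩ := hpb ν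
    exact hhi.mul_bdd (hpc ν).aestronglyMeasurable (Eventually.of_forall hC)
  have hint_pp : ∀ ν ν', Integrable (fun a => p ν a * p ν' a) μ := fun ν ν' => by
    obtain ⟨C, hC⟩ := hpb ν'
    exact (hpi ν).mul_bdd (hpc ν').aestronglyMeasurable (Eventually.of_forall hC)
  have hS1 : S = ∫ a, h a * g a ∂μ := by
    have : ∀ a : (ι → Matrix.specialUnitaryGroup (Fin 2) ℂ),
        h a * g a = ∑ ν ∈ F, h a * p ν a := fun a => by simp only [hg, Finset.mul_sum]
    simp_rw [this]
    rw [integral_finsetSum _ fun ν _ => hint_hp ν]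
    exact Finset.sum_congr rfl fun ν _ => hdiag ν
  have hS2 : ∫ a, g a ^ 2 ∂μ = S := by
    have : ∀ a : (ι → Matrix.specialUnitaryGroup (Fin 2) ℂ),
        g a ^ 2 = ∑ ν ∈ F, ∑ ν' ∈ F, p ν a * p ν' a := fun a => by
      rw [sq, hg, Finset.sum_mul_sum]
    simp_rw [this]
    rw [integral_finsetSum _ fun ν _ => integrable_finsetSum _ fun ν' _ => hint_pp ν ν']
    have hνν : ∀ ν ∈ F, ∫ a, ∑ ν' ∈ F, p ν a * p ν' a ∂μ = ∫ a, h a * p ν a ∂μ := by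
      intro ν hν
      rw [integral_finsetSum _ fun ν' _ => hint_pp ν ν']
      have hoff : ∀ ν' ∈ F, ∫ a, p ν a * p ν' a ∂μ = if ν = ν' then ∫ a, h a * p ν a ∂μ else 0 := by
        intro ν' _
        exact integral_charProj_mul_charProj ν ν' hhi hhi
      rw [Finset.sum_congr rfl hoff, Finset.sum_ite_eq, if_pos hν]
    rw [Finset.sum_congr rfl hνν]
    exact Finset.sum_congr rfl fun ν _ => (hdiag ν).symm
  have hCS : S ≤ Real.sqrt (∫ a, h a ^ 2 ∂μ) * Real.sqrt S := by
    calc S = ∫ a, h a * g a ∂μ := hS1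
      _ ≤ |∫ a, h a * g a ∂μ| := le_abs_self _
      _ ≤ Real.sqrt (∫ a, h a ^ 2 ∂μ) * Real.sqrt (∫ a, g a ^ 2 ∂μ) := abs_integral_mul_le_sqrt_mul_sqrt hh hg2
      _ = Real.sqrt (∫ a, h a ^ 2 ∂μ) * Real.sqrt S := by rw [hS2]
  have hh2 : 0 ≤ ∫ a, h a ^ 2 ∂μ := integral_nonneg fun a => sq_nonneg _
  have hsq : Real.sqrt S ≤ Real.sqrt (∫ a, h a ^ 2 ∂μ) := by
    by_cases h0 : Real.sqrt S = 0
    · rw [h0]; exact Real.sqrt_nonneg _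
    · have hpos : 0 < Real.sqrt S := lt_of_le_of_ne (Real.sqrt_nonneg _) (Ne.symm h0)
      have h3 : Real.sqrt S * Real.sqrt S ≤ Real.sqrt (∫ a, h a ^ 2 ∂μ) * Real.sqrt S := by
        rw [Real.mul_self_sqrt hSnn]; exact hCS
      exact le_of_mul_le_mul_right h3 hpos
  calc S = Real.sqrt S ^ 2 := (Real.sq_sqrt hSnn).symm
    _ ≤ Real.sqrt (∫ a, h a ^ 2 ∂μ) ^ 2 := pow_le_pow_left₀ (Real.sqrt_nonneg _) hsq 2
    _ = ∫ a, h a ^ 2 ∂μ := Real.sq_sqrt hh2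

/-- `|∫ ψ · p_ν h| ≤ (∫ (p_ν ψ)²)^{1/2} (∫ (p_ν h)²)^{1/2}` (reproducing property and Cauchy–Schwarz). [folklore] -/
theorem abs_integral_mul_charProj_le (ν : ι → ℕ)
    {ψ h : (ι → Matrix.specialUnitaryGroup (Fin 2) ℂ) → ℝ}
    (hψ : Integrable ψ ((Measure.pi fun _ : ι => haarProbability (Matrix.specialUnitaryGroup (Fin 2) ℂ))))
    (hh : Integrable h ((Measure.pi fun _ : ι => haarProbability (Matrix.specialUnitaryGroup (Fin 2) ℂ)))) :
    |∫ a, ψ a * ((∏ e, ((ν e : ℝ) + 1)) * ∫ b, (∏ e, (U ℝ (ν e)).eval (su2a0 (b e * (a e)⁻¹))) * h b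
          ∂((Measure.pi fun _ : ι => haarProbability (Matrix.specialUnitaryGroup (Fin 2) ℂ))))
        ∂((Measure.pi fun _ : ι => haarProbability (Matrix.specialUnitaryGroup (Fin 2) ℂ)))| ≤
      Real.sqrt (∫ a, ((∏ e, ((ν e : ℝ) + 1)) * ∫ b, (∏ e, (U ℝ (ν e)).eval (su2a0 (b e * (a e)⁻¹))) * ψ b
          ∂((Measure.pi fun _ : ι => haarProbability (Matrix.specialUnitaryGroup (Fin 2) ℂ)))) ^ 2
          ∂((Measure.pi fun _ : ι => haarProbability (Matrix.specialUnitaryGroup (Fin 2) ℂ)))) *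
        Real.sqrt (∫ a, ((∏ e, ((ν e : ℝ) + 1)) * ∫ b, (∏ e, (U ℝ (ν e)).eval (su2a0 (b e * (a e)⁻¹))) * h b
          ∂((Measure.pi fun _ : ι => haarProbability (Matrix.specialUnitaryGroup (Fin 2) ℂ)))) ^ 2
          ∂((Measure.pi fun _ : ι => haarProbability (Matrix.specialUnitaryGroup (Fin 2) ℂ)))) := by
  have h := integral_charProj_mul_charProj ν ν hψ hh
  rw [if_pos rfl] at h
  rw [← h]
  exact abs_integral_mul_le_sqrt_mul_sqrt (memLp_two_of_continuous (continuous_charProj ν hψ))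
    (memLp_two_of_continuous (continuous_charProj ν hh))

end Reproducing

end Summit.Ventures.YMGap.FlowData.SU2Links
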